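import Literature.MathematicalPhysics.QuantumManyBody.PeriodicBoseGas
import Literature.MathematicalPhysics.QuantumManyBody.PeriodicCellChangeOfVariables
import Literature.MathematicalPhysics.QuantumManyBody.PeriodicBoseGasFracEnergy
import Literature.MathematicalPhysics.QuantumManyBody.BoseGasFreeDirichletBEC
import Literature.MathematicalPhysics.QuantumManyBody.CondensateOccupationStability
import Literature.MathematicalPhysics.QuantumManyBody.SwapPurity
import Mathlib.Algebra.Order.Chebyshev

/-!
# Route `BECThomsonPrinciple`, crux `PeriodicToDirichlet` (stmt-AtomisticToContinuum-9483),
# line `Sketch` (torus-in-the-box-doob): registered stub `stub_torusFloorFromA` (G3)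

Where the hypothesis `A` enters the line: an `A`-instance on the torus of side `ℓ` with constant
`c'` is transported to the torus ground-state interface `Φ` (continuous, periodic, rigidly
translation invariant, `≥ 0`, normalised, `L²(cell)`-limit up to phase of all near-minimisers), and
local condensation from global for such `Φ` gives flat-mode occupation `≥ (c'/16)(m+1)` on every
sub-cube of side `ℓ/2` inside the cell. [folklore]

Proof. (1) A near-minimiser `Ψ` at slack `min δ_A δ₁` (the trial class is inhabited by the constant
state) has `n₀(Ψ) ≥ c'N` by `A` and `‖Ψ - e^{iθ}Φ‖²_{L²(cell)} ≤ (c'/4)²` by the interface, so the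
`2N√η`-Lipschitz bound of `n₀` and phase invariance give `n₀(Φ) ≥ (c'/2)N`. (2) With
`G_q(Y) = ∫_{Q_q} Φ(x,Y) dx` for the 8 sub-cubes `Q_q` of side `ℓ/2`, Cauchy–Schwarz gives
`n₀(Φ) = N ℓ⁻³ ∫ |∑_q G_q|² ≤ 8 N ℓ⁻³ ∑_q ∫ |G_q|²`. (3) For ANY shift `a`,
`∫_{cellⁿ} |∫_{a+[0,ℓ/2)³} Φ(x,Y)dx|² dY = ∫_{cellⁿ} |∫_{[0,ℓ/2)³} Φ(x,Y)dx|² dY` (translate `x`,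
move the shift to the spectators by rigid invariance, shift the cell by periodicity); hence
`n₀(Φ) ≤ 8 n_{C_u}(Φ)` for the sub-cube `C_u = u + [0,ℓ/2)³ ⊆ cell`, and `n_{C_u}(Φ) ≥ (c'/16)N`.
-/

noncomputable section

open MeasureTheory Filter
open scoped ENNReal NNReal

namespace Summit.AtomisticToContinuum.BoseEinsteinCondensation.TorusInTheBox

open Literature.MathematicalPhysics.QuantumManyBody.BoseGas
open scoped ComplexConjugate

section Helpers

variable {n : ℕ} {L : ℝ}

/-- **Non-vacuity**: for `L > 0` the constant state `(L^{-3/2})^N` is an admissible periodic trial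
state. [folklore] -/
private theorem nonempty_periodicTrialState (N : ℕ) (hL : 0 < L) :
    Nonempty (PeriodicTrialState N L) := by
  -- adapted from `periodicGroundStateEnergy_zero_eq_zero` (BoseGasDirichletWall.lean)
  have hL3 : 0 < L ^ 3 := by positivity
  have hc : ((‖(((Real.sqrt (L ^ 3))⁻¹ ^ N : ℝ) : ℂ)‖₊ : ℝ≥0∞) ^ 2) =
      ENNReal.ofReal (((L ^ 3)⁻¹) ^ N) := by
    rw [← ENNReal.coe_pow, ENNReal.ofReal, ENNReal.coe_inj]
    ext
    rw [NNReal.coe_pow, coe_nnnorm, Complex.norm_real, Real.norm_of_nonneg (by positivity),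
      ← pow_mul, mul_comm, pow_mul, inv_pow, Real.sq_sqrt hL3.le,
      Real.coe_toNNReal _ (by positivity)]
  exact ⟨{ ψ := fun _ => (((Real.sqrt (L ^ 3))⁻¹ ^ N : ℝ) : ℂ)
           contDiff := contDiff_const
           periodic := fun _ _ _ => rfl
           symm := fun _ _ => rfl
           norm_eq := by
             rw [setLIntegral_const, volume_cellN, hc, ← ENNReal.ofReal_pow hL.le,
               ← ENNReal.ofReal_pow (by positivity), ← ENNReal.ofReal_mul (by positivity),
               ← mul_pow, inv_mul_cancel₀ hL3.ne', one_pow, ENNReal.ofReal_one] }⟩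

/-- Near-minimisers of the periodic energy exist at every positive slack (`L > 0`). [folklore] -/
private theorem exists_nearMinimiser (v : ℝ → ℝ≥0∞) (N : ℕ) (hL : 0 < L) {δ : ℝ≥0∞}
    (hδ : 0 < δ) :
    ∃ Ψ : PeriodicTrialState N L, periodicEnergy v Ψ ≤ periodicGroundStateEnergy v N L + δ := by
  obtain ⟨Ψ₀⟩ := nonempty_periodicTrialState N hL
  by_cases htop : periodicGroundStateEnergy v N L = ⊤
  · exact ⟨Ψ₀, by rw [htop, top_add]; exact le_top⟩
  · have hlt : (⨅ Ψ : PeriodicTrialState N L, periodicEnergy v Ψ) <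
        periodicGroundStateEnergy v N L + δ :=
      ENNReal.lt_add_right htop hδ.ne'
    obtain ⟨Ψ, hΨ⟩ := iInf_lt_iff.mp hlt
    exact ⟨Ψ, hΨ.le⟩

/-- **Transport of the `A`-instance to the interface**: if every `δ_A`-near-minimiser has
`n₀ ≥ c'N` and all near-minimisers approach `e^{iθ}F` in `L²(cell)`, then `n₀(F) ≥ (c'/2)N`
(phase invariance and the `2N√η`-Lipschitz bound with `η = (c'/4)²`). [folklore] -/
private theorem condensate_floor_of_interface (v : ℝ → ℝ≥0∞) (m : ℕ) (hL : 0 < L) {c' : ℝ}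
    (hc' : 0 < c')
    (hA : ∃ δ : ℝ≥0∞, 0 < δ ∧ ∀ Ψ : PeriodicTrialState (m + 1) L,
        periodicEnergy v Ψ ≤ periodicGroundStateEnergy v (m + 1) L + δ →
          ENNReal.ofReal (c' * (m + 1 : ℕ)) ≤ condensateOccupation (m + 1) L Ψ.ψ)
    {F : Config (m + 1) → ℂ} (hF : Continuous F)
    (hF1 : ∫⁻ X in cellN (m + 1) L, (‖F X‖₊ : ℝ≥0∞) ^ 2 = 1)
    (happrox : ∀ η : ℝ, 0 < η → ∃ δ : ℝ≥0∞, 0 < δ ∧ ∀ Ψ : PeriodicTrialState (m + 1) L,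
        periodicEnergy v Ψ ≤ periodicGroundStateEnergy v (m + 1) L + δ →
          ∃ θ : ℝ, ∫ X in cellN (m + 1) L,
            ‖Ψ.ψ X - Complex.exp (θ * Complex.I) * F X‖ ^ 2 ≤ η) :
    ENNReal.ofReal (c' / 2 * (m + 1 : ℕ)) ≤ condensateOccupation (m + 1) L F := by
  obtain ⟨δA, hδA, hAδ⟩ := hA
  obtain ⟨δ₁, hδ₁, h₁⟩ := happrox ((c' / 4) ^ 2) (by positivity)
  obtain ⟨Ψ, hΨ⟩ := exists_nearMinimiser v (m + 1) hL (lt_min hδA hδ₁)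
  have hocc := hAδ Ψ (hΨ.trans (add_le_add_right (min_le_left _ _) _))
  obtain ⟨θ, hθ⟩ := h₁ Ψ (hΨ.trans (add_le_add_right (min_le_right _ _) _))
  have hG : Continuous fun X => Complex.exp (θ * Complex.I) * F X := continuous_const.mul hF
  have hG1 : ∫⁻ X in cellN (m + 1) L,
      (‖Complex.exp (θ * Complex.I) * F X‖₊ : ℝ≥0∞) ^ 2 ≤ 1 := by
    simp only [coe_nnnorm_mul_sq, coe_nnnorm_exp_mul_I_sq, one_mul]
    exact hF1.le
  have hlip := condensateOccupation_le_add_of_sq_dist_le hL Ψ.contDiff.continuous hG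
    Ψ.norm_eq.le hG1 hθ
  rw [condensateOccupation_phase_mul, Real.sqrt_sq (by positivity)] at hlip
  have hε : ENNReal.ofReal (2 * ((m + 1 : ℕ) : ℝ) * (c' / 4)) =
      ENNReal.ofReal (c' / 2 * ((m + 1 : ℕ) : ℝ)) := by congr 1; ring
  rw [hε] at hlip
  have h := ofReal_sub_mul_le_of_le_add (c := c') (ε := c' / 2) (by positivity) (m + 1)
    (hocc.trans hlip)
  rwa [show c' - c' / 2 = c' / 2 by ring] at h

/-- `2 · (L/2) = L` with the natural-number cast. [folklore] -/
private theorem two_mul_half (L : ℝ) : ((2 : ℕ) : ℝ) * (L / 2) = L := by push_cast; ring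

/-- Every sub-cube of side `L/2` at a lattice corner lies in the cell. [folklore] -/
private theorem subCell_subset_cell₂ (hL : 0 < L) (q : SubIdx 2) : subCell (L / 2) q ⊆ cell L := by
  have h := subCell_subset_cell (half_pos hL) q
  rwa [two_mul_half L] at h

/-- The 8 sub-cubes of side `L/2` cover the cell `[0,L)³`. [folklore] -/
private theorem iUnion_subCell_eq (hL : 0 < L) : ⋃ q : SubIdx 2, subCell (L / 2) q = cell L := by
  -- adapted from …Theorems/BECThomsonPrinciplePeriodicToDirichletTorusLocalCondensation.lean
  ext x
  simp only [Set.mem_iUnion]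
  constructor
  · rintro ⟨q, hq⟩
    exact subCell_subset_cell₂ hL q hq
  · intro hx
    rw [← two_mul_half L] at hx
    exact exists_mem_subCell (half_pos hL) hx

/-- Distinct sub-cubes are disjoint. [folklore] -/
private theorem pairwise_disjoint_subCell (hs : 0 < L / 2) :
    Pairwise (Function.onFun Disjoint fun q : SubIdx 2 => subCell (L / 2) q) := fun _ _ hqq' =>
  Set.disjoint_left.mpr fun _ hx => not_mem_subCell_of_ne hs hqq' hx

/-- **The cell integral of a slice splits over the 8 sub-cubes**: `∫_cell F(x,Y) dx = ∑_q G_q(Y)`.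
[folklore] -/
private theorem setIntegral_cell_eq_sum_sliceInt (hL : 0 < L) {F : Config (n + 1) → ℂ}
    (hF : Continuous F) (Y : Config n) :
    ∫ x in cell L, F (Matrix.vecCons x Y) =
      ∑ q : SubIdx 2, ∫ x in subCell (L / 2) q, F (Matrix.vecCons x Y) := by
  -- adapted from …Theorems/BECThomsonPrinciplePeriodicToDirichletTorusLocalCondensation.lean
  rw [← iUnion_subCell_eq hL]
  exact integral_iUnion_fintype (fun q => measurableSet_subCell _ q)
    (pairwise_disjoint_subCell (half_pos hL)) fun q =>
      (integrableOn_cell (hF.comp (continuous_id.matrixVecCons continuous_const))).mono_set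
        (subCell_subset_cell₂ hL q)

/-- **Translation + rigid invariance**: `∫_{a+[0,s)³} F(x, Y) dx = ∫_{[0,s)³} F(x, Y - (a,…,a)) dx`.
[folklore] -/
private theorem sliceInt_cellShift {F : Config (n + 1) → ℂ}
    (hrig : ∀ (a : Space) (X : Config (n + 1)), F (fun l => X l + a) = F X)
    (s : ℝ) (a : Space) (Y : Config n) :
    ∫ x in cellShift s a, F (Matrix.vecCons x Y) =
      ∫ x in cell s, F (Matrix.vecCons x (Y - fun _ : Fin n => a)) := by
  rw [← setIntegral_cell_comp_add s (fun x => F (Matrix.vecCons x Y)) a]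
  refine integral_congr_ae (Eventually.of_forall fun x => ?_)
  show F (Matrix.vecCons (x + a) Y) = F (Matrix.vecCons x (Y - fun _ : Fin n => a))
  rw [← hrig a (Matrix.vecCons x (Y - fun _ : Fin n => a))]
  congr 1
  funext l
  refine Fin.cases ?_ (fun m => ?_) l
  · simp
  · simp

/-- `x :: (Y + e_m ⊗ u) = (x :: Y) + e_{m+1} ⊗ u`. [folklore] -/
private theorem cons_add_single_succ (x : Space) (Y : Config n) (m : Fin n) (u : Space) :
    (Matrix.vecCons x (Y + Pi.single m u) : Config (n + 1)) =
      Matrix.vecCons x Y + Pi.single m.succ u := by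
  -- adapted from …Theorems/BECThomsonPrinciplePeriodicToDirichletTorusLocalCondensation.lean
  funext i
  refine Fin.cases ?_ (fun m' => ?_) i
  · simp [Ne.symm (Fin.succ_ne_zero m)]
  · by_cases h : m' = m
    · subst h; simp
    · simp [h, Fin.succ_inj]

/-- Slice integrals of a lattice-periodic function are lattice periodic in every spectator.
[folklore] -/
private theorem sliceInt_add_single {F : Config (n + 1) → ℂ}
    (hper : ∀ (X : Config (n + 1)) (i : Fin (n + 1)) (k : Fin 3),
      F (X + Pi.single i (EuclideanSpace.single k L)) = F X)
    (Q : Set Space) (Y : Config n) (m : Fin n) (c : Fin 3) :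
    ∫ x in Q, F (Matrix.vecCons x (Y + Pi.single m (EuclideanSpace.single c L))) =
      ∫ x in Q, F (Matrix.vecCons x Y) := by
  refine integral_congr_ae (Eventually.of_forall fun x => ?_)
  show F (Matrix.vecCons x (Y + Pi.single m (EuclideanSpace.single c L))) =
    F (Matrix.vecCons x Y)
  rw [cons_add_single_succ, hper]

/-- **The key identity** (shift of the fundamental cell): for ANY shift `a`,
`∫_{cellⁿ} |∫_{a+[0,s)³} F(x,Y) dx|² dY = ∫_{cellⁿ} |∫_{[0,s)³} F(x,Y) dx|² dY` for a continuous,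
lattice-periodic, rigidly translation-invariant `F`. [folklore] -/
private theorem lintegral_sliceInt_cellShift (hL : 0 < L) {F : Config (n + 1) → ℂ}
    (hper : ∀ (X : Config (n + 1)) (i : Fin (n + 1)) (k : Fin 3),
      F (X + Pi.single i (EuclideanSpace.single k L)) = F X)
    (hrig : ∀ (a : Space) (X : Config (n + 1)), F (fun l => X l + a) = F X)
    (s : ℝ) (a : Space) :
    ∫⁻ Y in cellN n L, (‖∫ x in cellShift s a, F (Matrix.vecCons x Y)‖₊ : ℝ≥0∞) ^ 2 =
      ∫⁻ Y in cellN n L, (‖∫ x in cell s, F (Matrix.vecCons x Y)‖₊ : ℝ≥0∞) ^ 2 := by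
  -- adapted from `lintegral_sliceInt_eq` of …TorusLocalCondensation.lean (general shift)
  calc ∫⁻ Y in cellN n L, (‖∫ x in cellShift s a, F (Matrix.vecCons x Y)‖₊ : ℝ≥0∞) ^ 2
      = ∫⁻ Y in cellN n L, (‖∫ x in cell s,
          F (Matrix.vecCons x (Y + -fun _ : Fin n => a))‖₊ : ℝ≥0∞) ^ 2 := by
        refine lintegral_congr fun Y => ?_
        rw [sliceInt_cellShift hrig s a Y, sub_eq_add_neg]
    _ = ∫⁻ Y in cellN n L, (‖∫ x in cell s, F (Matrix.vecCons x Y)‖₊ : ℝ≥0∞) ^ 2 :=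
        lintegral_cellN_comp_add hL
          (G := fun Y => (‖∫ x in cell s, F (Matrix.vecCons x Y)‖₊ : ℝ≥0∞) ^ 2)
          (fun Y m c => by simp only [sliceInt_add_single hper]) _

/-- `‖∑ᵢ aᵢ‖² ≤ #s · ∑ᵢ ‖aᵢ‖²` in `ℝ≥0∞` (Cauchy–Schwarz). [folklore] -/
private theorem ennnorm_sum_sq_le {ι : Type*} (s : Finset ι) (a : ι → ℂ) :
    (‖∑ i ∈ s, a i‖₊ : ℝ≥0∞) ^ 2 ≤ (s.card : ℝ≥0∞) * ∑ i ∈ s, (‖a i‖₊ : ℝ≥0∞) ^ 2 := by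
  -- adapted from …Theorems/BECThomsonPrinciplePeriodicToDirichletTorusLocalCondensation.lean
  have h1 : ‖∑ i ∈ s, a i‖₊ ≤ ∑ i ∈ s, ‖a i‖₊ := nnnorm_sum_le s a
  have h2 : (∑ i ∈ s, ‖a i‖₊) ^ 2 ≤ s.card * ∑ i ∈ s, ‖a i‖₊ ^ 2 := sq_sum_le_card_mul_sum_sq
  have h3 : ‖∑ i ∈ s, a i‖₊ ^ 2 ≤ s.card * ∑ i ∈ s, ‖a i‖₊ ^ 2 :=
    (pow_le_pow_left' h1 2).trans h2
  have h4 : ((‖∑ i ∈ s, a i‖₊ ^ 2 : ℝ≥0) : ℝ≥0∞) ≤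
      ((s.card * ∑ i ∈ s, ‖a i‖₊ ^ 2 : ℝ≥0) : ℝ≥0∞) :=
    ENNReal.coe_le_coe.mpr h3
  push_cast at h4
  exact h4

/-- `‖(√v)⁻¹‖₊² = v⁻¹` in `ℝ≥0∞` for `v > 0`. [folklore] -/
private theorem ennnorm_inv_sqrt_sq {v : ℝ} (hv : 0 < v) :
    ((‖((Real.sqrt v : ℝ) : ℂ)⁻¹‖₊ : ℝ≥0∞)) ^ 2 = ENNReal.ofReal v⁻¹ := by
  rw [coe_nnnorm_sq_eq_ofReal, norm_inv, Complex.norm_real,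
    Real.norm_of_nonneg (Real.sqrt_nonneg _), inv_pow, Real.sq_sqrt hv.le]

/-- **Occupation of the flat mode `c·1_Q`** of a measurable `Q ⊆ cell`:
`(n+1) ∫_{cellⁿ} ‖c‖² |∫_Q F(x,Y) dx|² dY`. [folklore] -/
private theorem cellOccupation_indicator_const (L : ℝ) {Q : Set Space} (hQ : MeasurableSet Q)
    (hQc : Q ⊆ cell L) (c : ℂ) (F : Config (n + 1) → ℂ) :
    cellOccupation (n + 1) L (Q.indicator fun _ => c) F =
      (n + 1 : ℝ≥0∞) * ∫⁻ Y in cellN n L,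
        (‖c‖₊ : ℝ≥0∞) ^ 2 * (‖∫ x in Q, F (Matrix.vecCons x Y)‖₊ : ℝ≥0∞) ^ 2 := by
  rw [cellOccupation_succ]
  congr 1
  refine lintegral_congr fun Y => ?_
  have hind : (fun x => conj (Q.indicator (fun _ => c) x) * F (Matrix.vecCons x Y)) =
      Q.indicator fun x => conj c * F (Matrix.vecCons x Y) := by
    funext x
    by_cases hx : x ∈ Q
    · simp [hx]
    · simp [hx]
  rw [hind, integral_indicator hQ, Measure.restrict_restrict hQ, Set.inter_eq_left.mpr hQc,
    integral_const_mul, nnnorm_mul, RCLike.nnnorm_conj, ENNReal.coe_mul, mul_pow]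

/-- **Local condensation from global for a continuous, lattice-periodic, rigidly
translation-invariant `F`** (`k = 2`): `n₀(F) ≤ 8 · n_{a + [0,L/2)³}(F)` for every sub-cube
`a + [0,L/2)³ ⊆ [0,L)³`. [folklore] -/
private theorem condensateOccupation_le_eight_mul (hL : 0 < L) {F : Config (n + 1) → ℂ}
    (hF : Continuous F)
    (hper : ∀ (X : Config (n + 1)) (i : Fin (n + 1)) (k : Fin 3),
      F (X + Pi.single i (EuclideanSpace.single k L)) = F X)
    (hrig : ∀ (a : Space) (X : Config (n + 1)), F (fun l => X l + a) = F X)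
    {a : Space} (ha : cellShift (L / 2) a ⊆ cell L) :
    condensateOccupation (n + 1) L F ≤ 8 * cellOccupation (n + 1) L
      ((cellShift (L / 2) a).indicator fun _ => ((Real.sqrt ((L / 2) ^ 3))⁻¹ : ℂ)) F := by
  -- the two normalisation constants
  set c₀ : ℂ := ((Real.sqrt (L ^ 3))⁻¹ : ℂ)
  set c₁ : ℂ := ((Real.sqrt ((L / 2) ^ 3))⁻¹ : ℂ) with hc₁
  have hn₀ : ((‖c₀‖₊ : ℝ≥0∞)) ^ 2 = ENNReal.ofReal (L ^ 3)⁻¹ := ennnorm_inv_sqrt_sq (by positivity)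
  have hn₁ : ((‖c₁‖₊ : ℝ≥0∞)) ^ 2 = 8 * ENNReal.ofReal (L ^ 3)⁻¹ := by
    have h : ((L / 2) ^ 3)⁻¹ = 8 * (L ^ 3)⁻¹ := by
      rw [div_pow, inv_div, div_eq_mul_inv]
      norm_num
    rw [hc₁, ennnorm_inv_sqrt_sq (by positivity), h, ENNReal.ofReal_mul (by norm_num),
      ENNReal.ofReal_ofNat]
  -- the common value of all sub-cube slice norms (key identity)
  set I : ℝ≥0∞ := ∫⁻ Y in cellN n L,
    (‖∫ x in cell (L / 2), F (Matrix.vecCons x Y)‖₊ : ℝ≥0∞) ^ 2 with hI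
  have hkey : ∀ b : Space, ∫⁻ Y in cellN n L,
      (‖∫ x in cellShift (L / 2) b, F (Matrix.vecCons x Y)‖₊ : ℝ≥0∞) ^ 2 = I :=
    fun b => lintegral_sliceInt_cellShift hL hper hrig (L / 2) b
  have hq : ∀ q : SubIdx 2, ∫⁻ Y in cellN n L,
      (‖∫ x in subCell (L / 2) q, F (Matrix.vecCons x Y)‖₊ : ℝ≥0∞) ^ 2 = I :=
    fun q => hkey (subOffset (L / 2) q)
  -- right-hand side
  have hRHS : cellOccupation (n + 1) L ((cellShift (L / 2) a).indicator fun _ => c₁) F =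
      (n + 1 : ℝ≥0∞) * ((‖c₁‖₊ : ℝ≥0∞) ^ 2 * I) := by
    rw [cellOccupation_indicator_const L (measurableSet_cellShift _ a) ha,
      lintegral_const_mul' _ _ (ENNReal.pow_ne_top ENNReal.coe_ne_top), hkey]
  -- left-hand side through the slice integrals `G_q(Y) = ∫_{Q_q} F(x, Y) dx`
  have hLHS : condensateOccupation (n + 1) L F = cellOccupation (n + 1) L (fun _ => c₀) F := rfl
  have hpt₀ : ∀ Y : Config n,
      (‖∫ x in cell L, conj c₀ * F (Matrix.vecCons x Y)‖₊ : ℝ≥0∞) ^ 2 =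
        (‖c₀‖₊ : ℝ≥0∞) ^ 2 *
          (‖∑ q : SubIdx 2, ∫ x in subCell (L / 2) q, F (Matrix.vecCons x Y)‖₊ : ℝ≥0∞) ^ 2 := by
    intro Y
    rw [integral_const_mul, setIntegral_cell_eq_sum_sliceInt hL hF Y, nnnorm_mul,
      RCLike.nnnorm_conj, ENNReal.coe_mul, mul_pow]
  have hmeas : ∀ q : SubIdx 2, Measurable fun Y : Config n =>
      (‖∫ x in subCell (L / 2) q, F (Matrix.vecCons x Y)‖₊ : ℝ≥0∞) ^ 2 :=
    fun q => measurable_sliceSetIntegral_sq hF _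
  have hcard : ((Finset.univ : Finset (SubIdx 2)).card : ℝ≥0∞) = 8 := by
    rw [Finset.card_univ, Fintype.card_fun, Fintype.card_fin, Fintype.card_fin]
    norm_num
  have hCS : ∀ Y : Config n,
      (‖∑ q : SubIdx 2, ∫ x in subCell (L / 2) q, F (Matrix.vecCons x Y)‖₊ : ℝ≥0∞) ^ 2 ≤
        8 * ∑ q : SubIdx 2,
          (‖∫ x in subCell (L / 2) q, F (Matrix.vecCons x Y)‖₊ : ℝ≥0∞) ^ 2 := fun Y => by
    have h := ennnorm_sum_sq_le Finset.univ
      (fun q : SubIdx 2 => ∫ x in subCell (L / 2) q, F (Matrix.vecCons x Y))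
    rwa [hcard] at h
  have htop₀ : ((‖c₀‖₊ : ℝ≥0∞)) ^ 2 ≠ ⊤ := ENNReal.pow_ne_top ENNReal.coe_ne_top
  rw [hRHS, hLHS, cellOccupation_succ]
  simp only [hpt₀]
  calc (n + 1 : ℝ≥0∞) * ∫⁻ Y in cellN n L, (‖c₀‖₊ : ℝ≥0∞) ^ 2 *
          (‖∑ q : SubIdx 2, ∫ x in subCell (L / 2) q, F (Matrix.vecCons x Y)‖₊ : ℝ≥0∞) ^ 2
      ≤ (n + 1 : ℝ≥0∞) * ∫⁻ Y in cellN n L, (‖c₀‖₊ : ℝ≥0∞) ^ 2 * (8 *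
          ∑ q : SubIdx 2,
            (‖∫ x in subCell (L / 2) q, F (Matrix.vecCons x Y)‖₊ : ℝ≥0∞) ^ 2) := by
        gcongr with Y
        exact hCS Y
    _ = (n + 1 : ℝ≥0∞) * ((‖c₀‖₊ : ℝ≥0∞) ^ 2 * (8 *
          ∑ q : SubIdx 2, ∫⁻ Y in cellN n L,
            (‖∫ x in subCell (L / 2) q, F (Matrix.vecCons x Y)‖₊ : ℝ≥0∞) ^ 2)) := by
        rw [lintegral_const_mul' _ _ htop₀, lintegral_const_mul' _ _ ENNReal.ofNat_ne_top,
          lintegral_finsetSum _ fun q _ => hmeas q]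
    _ = (n + 1 : ℝ≥0∞) * ((‖c₀‖₊ : ℝ≥0∞) ^ 2 * (8 * (8 * I))) := by
        simp only [hq]
        rw [Finset.sum_const, nsmul_eq_mul, hcard]
    _ = 8 * ((n + 1 : ℝ≥0∞) * ((‖c₁‖₊ : ℝ≥0∞) ^ 2 * I)) := by
        rw [hn₀, hn₁]
        ring

end Helpers

/-- **Registered stub `stub_torusFloorFromA`** (G3 of line `Sketch`, crux stmt-AtomisticToContinuum-9483;
the skeleton's `TorusFloorFromA`, with the interface `IsTorusGS` unfolded). [folklore] -/
theorem stub_torusFloorFromA :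
    ∀ (v : ℝ → ℝ≥0∞) (m : ℕ) (ℓ : ℝ), 0 < ℓ → ∀ c' : ℝ, 0 < c' →
      (∃ δ : ℝ≥0∞, 0 < δ ∧ ∀ Ψ : PeriodicTrialState (m + 1) ℓ,
        periodicEnergy v Ψ ≤ periodicGroundStateEnergy v (m + 1) ℓ + δ →
          ENNReal.ofReal (c' * (m + 1 : ℕ)) ≤ condensateOccupation (m + 1) ℓ Ψ.ψ) →
      ∀ Φ : Config (m + 1) → ℝ,
        (Continuous Φ ∧
          (∀ (X : Config (m + 1)) (i : Fin (m + 1)) (k : Fin 3),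
            Φ (X + Pi.single i (EuclideanSpace.single k ℓ)) = Φ X) ∧
          (∀ (a : Space) (X : Config (m + 1)), Φ (fun i => X i + a) = Φ X) ∧
          (∀ X, 0 ≤ Φ X) ∧
          (∫⁻ X in cellN (m + 1) ℓ, (‖(Φ X : ℂ)‖₊ : ℝ≥0∞) ^ 2 = 1) ∧
          ∀ η : ℝ, 0 < η → ∃ δ : ℝ≥0∞, 0 < δ ∧ ∀ Ψ : PeriodicTrialState (m + 1) ℓ,
            periodicEnergy v Ψ ≤ periodicGroundStateEnergy v (m + 1) ℓ + δ →
              ∃ θ : ℝ, ∫ X in cellN (m + 1) ℓ,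
                ‖Ψ.ψ X - Complex.exp (θ * Complex.I) * (Φ X : ℂ)‖ ^ 2 ≤ η) →
        ∀ u : Fin 3 → ℝ, (∀ t, 0 ≤ u t ∧ u t + ℓ / 2 ≤ ℓ) →
          ENNReal.ofReal (c' / 16 * (m + 1 : ℕ)) ≤
            cellOccupation (m + 1) ℓ
              (Set.indicator {x : Space | ∀ t, x t - u t ∈ Set.Ico 0 (ℓ / 2)}
                (fun _ => ((Real.sqrt ((ℓ / 2) ^ 3))⁻¹ : ℂ))) (fun X => (Φ X : ℂ)) := by
  intro v m ℓ hℓ c' hc' hA Φ hΦ u hu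
  obtain ⟨hcont, hper, hrig, -, hnorm, happrox⟩ := hΦ
  -- the complexified interface
  have hFc : Continuous fun X => (Φ X : ℂ) := Complex.continuous_ofReal.comp hcont
  have hFper : ∀ (X : Config (m + 1)) (i : Fin (m + 1)) (k : Fin 3),
      ((Φ (X + Pi.single i (EuclideanSpace.single k ℓ)) : ℝ) : ℂ) = (Φ X : ℂ) :=
    fun X i k => by rw [hper]
  have hFrig : ∀ (a : Space) (X : Config (m + 1)), ((Φ (fun i => X i + a) : ℝ) : ℂ) = (Φ X : ℂ) :=
    fun a X => by rw [hrig]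
  -- Step 1: transport of `A` to `Φ`
  have hfloor : ENNReal.ofReal (c' / 2 * (m + 1 : ℕ)) ≤
      condensateOccupation (m + 1) ℓ fun X => (Φ X : ℂ) :=
    condensate_floor_of_interface v m hℓ hc' hA hFc hnorm happrox
  -- Steps 2–3: local condensation at the sub-cube `u + [0,ℓ/2)³ ⊆ [0,ℓ)³`
  have hset : {x : Space | ∀ t, x t - u t ∈ Set.Ico 0 (ℓ / 2)} =
      cellShift (ℓ / 2) (WithLp.toLp 2 u) := by
    ext x
    simp only [cellShift, cell, Set.mem_setOf_eq, PiLp.sub_apply]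
  have hsub : cellShift (ℓ / 2) (WithLp.toLp 2 u) ⊆ cell ℓ := by
    intro x hx k
    rw [mem_cellShift] at hx
    obtain ⟨h1, h2⟩ := hx k
    have e : (WithLp.toLp 2 u : Space) k = u k := rfl
    rw [e] at h1 h2
    obtain ⟨hu1, hu2⟩ := hu k
    rw [Set.mem_Ico]
    constructor <;> linarith
  rw [hset]
  have hloc := condensateOccupation_le_eight_mul hℓ hFc hFper hFrig hsub
  have h8 : ENNReal.ofReal (c' / 2 * (m + 1 : ℕ)) = 8 * ENNReal.ofReal (c' / 16 * (m + 1 : ℕ)) := by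
    rw [← ENNReal.ofReal_ofNat 8, ← ENNReal.ofReal_mul (by norm_num)]
    congr 1
    ring
  rw [h8] at hfloor
  exact (ENNReal.mul_le_mul_iff_right (by norm_num) ENNReal.ofNat_ne_top).mp (hfloor.trans hloc)

end Summit.AtomisticToContinuum.BoseEinsteinCondensation.TorusInTheBox

end
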